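import Mathlib
import Literature.Probability.LatticeModels.ScalingLimit
import HarnessLib

/-!
# The exact mesh reparametrisation and "geometric mesh sequence + dilations ⇒ full filter"
# (crux `MoebiusLimitOfTwoPointLaw`, item stmt-CriticalPhenomena-4801; line `SketchIdeator5R2` =
# card `inversion-buys-the-filter`, Lemma A; `--supports stmt-CriticalPhenomena-4801`)

Model-blind bookkeeping for the CANONICAL renormalisation `ρ(δ) = δ^{-Δ}` of an arbitrary lattice
family `G` on `ℤ^d` (any dimension `d`, any `Δ : ℝ`):

* `latticeApprox_mesh_div`, `rescaledCorrelator_mesh_div`: the exact mesh identity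
  `S^{u/c}_n(x) = c^{nΔ} · S^{u}_n(c • x)` (`u, c > 0`) — the SAME spins are read on both sides
  (`[x/(u/c)] = [(c x)/u]`), only the power of the mesh is redistributed.
* `tendstoLocallyUniformlyOn_nhdsGT_of_geometricMesh` (**Lemma A**): if the canonically
  renormalised `n`-point correlators converge locally uniformly off the diagonals along ONE
  geometric mesh sequence `δ_k = b^{-k}` (`b > 1`) to `Tₙ`, and `Tₙ` is dilation covariant with
  weight `Δ` for the factors `c ∈ [1, b]` on non-coincident configurations, then they converge to
  `Tₙ` along the FULL filter `δ → 0⁺`. Proof: write `δ = b^{-k}/c` with `c ∈ [1, b]`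
  (`exists_nat_pow_near`, no logarithms); by the mesh identity `S^δ_n(x) = c^{nΔ} S^{b^{-k}}_n(c•x)`
  and by covariance `Tₙ(x) = c^{nΔ} Tₙ(c•x)`; the dilates `{c • y : c ∈ [1,b], y ∈ K}` of a compact
  `K ⊆ NonCoincident` form a compact subset of `NonCoincident`, on which the sequence is uniformly
  close to `Tₙ` for `k ≥ k₀`, and `c^{nΔ} ≤ b^{|nΔ|}`.
* `tendstoLocallyUniformlyOn_nhdsGT_of_dyadic`: the dyadic case `b = 2` on `ℤ³` with global scale
  covariance of `Tₙ`, in the shape consumed by the reduction of the crux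
  (`…MoebiusLimitOfTwoPointLawDyadicReduction.lean`).

Why this matters for the crux: under the two-point law (item 0634) the renormalisation IS the
canonical one (crux disprover, `Negative/CanonicalForm.lean`), so the reparametrisation is exact;
for a non-power `ρ` the ratio `ρ(b^{-k}/c)/ρ(b^{-k})` need not converge and "one mesh sequence ⇒
full filter" fails (tree witness `PointwiseScalingLimitDiscreteScaleInvariance.lean`).
References: crux workfile `Cruxes/MoebiusLimitOfTwoPointLaw/SketchIdeator5R2.lean` (ideator's
sketch, same proofs); Di Francesco–Mathieu–Sénéchal 1997 §4.3.1 (dilation covariance). No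
definitions, no `sorry`; nothing here is specific to the Ising model. [folklore]
-/

noncomputable section

namespace Summit.CriticalPhenomena.Ising3DConformalLimit.PrecisionLaplacianMoebiusLimitOfTwoPointLaw

open Literature.Probability.LatticeModels Filter Topology

variable {d : ℕ}

/-! ### The exact mesh identity -/

/-- Rounding commutes with the reparametrisation `δ = u/c ↦ (u, c • y)`: `[y/(u/c)] = [(c•y)/u]`
coordinatewise (`y_j/(u/c) = (c y_j)/u`). [folklore] -/
theorem latticeApprox_mesh_div (u c : ℝ) (y : EuclideanSpace ℝ (Fin d)) :
    latticeApprox (u / c) y = latticeApprox u (c • y) := by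
  funext j
  simp only [latticeApprox_apply, PiLp.smul_apply, smul_eq_mul]
  congr 1
  rw [div_div_eq_mul_div, mul_comm]

/-- **Exact mesh identity** for the canonical renormalisation `ρ(δ) = δ^{-Δ}`: for `u, c > 0` and
ANY lattice family `G` on `ℤ^d`, `S^{u/c}_n(x) = c^{nΔ} · S^{u}_n(c • x)` — the same spins are read
on both sides, and `(u/c)^{-nΔ} = c^{nΔ} u^{-nΔ}`. [folklore] -/
theorem rescaledCorrelator_mesh_div (G : LatticeCorrFamily d) (Δ : ℝ) (n : ℕ) {u c : ℝ}
    (hu : 0 < u) (hc : 0 < c) (x : Fin n → EuclideanSpace ℝ (Fin d)) :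
    rescaledCorrelator G (fun δ => δ ^ (-Δ)) n (u / c) x
      = c ^ ((n : ℝ) * Δ) * rescaledCorrelator G (fun δ => δ ^ (-Δ)) n u (fun i => c • x i) := by
  simp only [rescaledCorrelator_apply]
  have h1 : (fun i => latticeApprox (u / c) (x i)) = fun i => latticeApprox u (c • x i) := by
    funext i
    exact latticeApprox_mesh_div u c (x i)
  have h2 : (u / c) ^ (-Δ) = c ^ Δ * u ^ (-Δ) := by
    rw [Real.div_rpow hu.le hc.le, Real.rpow_neg hc.le, div_inv_eq_mul, mul_comm]
  have h3 : (c ^ Δ) ^ n = c ^ ((n : ℝ) * Δ) := by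
    rw [← Real.rpow_mul_natCast hc.le, mul_comm]
  rw [h1, h2, mul_pow, h3, mul_assoc]

/-! ### Lemma A: one geometric mesh sequence + dilation covariance ⇒ the full filter -/

/-- **Lemma A** (model-blind; any dimension `d`, any `Δ`, any base `b > 1`). If the canonically
renormalised `n`-point correlators `δ^{-nΔ} G n ([x₁/δ],…,[xₙ/δ])` of a lattice family `G` converge
locally uniformly on `NonCoincident d n` along the geometric mesh sequence `δ_k = b^{-k}` to `Tₙ`,
and `Tₙ (c • x) = c^{-nΔ} Tₙ x` for all `c ∈ [1, b]` and all non-coincident `x`, then they converge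
to `Tₙ` locally uniformly along the full filter `δ → 0⁺`. (Write `δ = b^{-k}/c`, `c ∈ [1,b]`, and use
`rescaledCorrelator_mesh_div` on the compact set of dilates `[1,b] • K ⊆ NonCoincident`.)
[folklore] -/
theorem tendstoLocallyUniformlyOn_nhdsGT_of_geometricMesh :
    ∀ (G : LatticeCorrFamily d) (Δ : ℝ) (n : ℕ) (Tn : (Fin n → EuclideanSpace ℝ (Fin d)) → ℝ)
      (b : ℝ), 1 < b →
      TendstoLocallyUniformlyOn
        (fun k : ℕ => rescaledCorrelator G (fun δ => δ ^ (-Δ)) n ((b ^ k)⁻¹)) Tn atTop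
        (NonCoincident d n) →
      (∀ c : ℝ, 1 ≤ c → c ≤ b → ∀ x ∈ NonCoincident d n,
        Tn (fun i => c • x i) = c ^ (-(n : ℝ) * Δ) * Tn x) →
      TendstoLocallyUniformlyOn (rescaledCorrelator G (fun δ => δ ^ (-Δ)) n) Tn (𝓝[>] (0 : ℝ))
        (NonCoincident d n) := by
  intro G Δ n Tn b hb hd hsc
  have hb0 : 0 < b := lt_trans one_pos hb
  rw [tendstoLocallyUniformlyOn_iff_forall_isCompact (isOpen_nonCoincident d n)] at hd ⊢
  intro K hK hKc
  -- the compact set of dilated configurations `c • y`, `c ∈ [1, b]`, `y ∈ K`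
  set Φ : ℝ × (Fin n → EuclideanSpace ℝ (Fin d)) → (Fin n → EuclideanSpace ℝ (Fin d)) :=
    fun p => fun i => p.1 • p.2 i with hΦ
  have hΦc : Continuous Φ :=
    continuous_pi fun i => continuous_fst.smul ((continuous_apply i).comp continuous_snd)
  set K' : Set (Fin n → EuclideanSpace ℝ (Fin d)) := Φ '' (Set.Icc (1:ℝ) b ×ˢ K) with hK'
  have hK'c : IsCompact K' := (isCompact_Icc.prod hKc).image hΦc
  have hK'sub : K' ⊆ NonCoincident d n := by
    rintro _ ⟨⟨c, y⟩, ⟨hc, hy⟩, rfl⟩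
    have hc0 : (c : ℝ) ≠ 0 := by
      have : (1:ℝ) ≤ c := hc.1
      positivity
    have hyinj : Function.Injective y := hK hy
    show Function.Injective fun i => c • y i
    intro i j hij
    exact hyinj (smul_right_injective (EuclideanSpace ℝ (Fin d)) hc0 (by simpa using hij))
  have hU := hd K' hK'sub hK'c
  rw [Metric.tendstoUniformlyOn_iff] at hU ⊢
  intro ε hε
  set M : ℝ := b ^ |(n : ℝ) * Δ| with hM
  have hMpos : 0 < M := by positivity
  obtain ⟨k₀, hk₀⟩ := eventually_atTop.1 (hU (ε / M) (by positivity))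
  have hpos₀ : (0:ℝ) < (b ^ k₀)⁻¹ := by positivity
  filter_upwards [Ioo_mem_nhdsGT hpos₀] with δ hδ y hy
  obtain ⟨hδ0, hδ1⟩ := hδ
  -- `δ ≤ 1`, hence `1 ≤ δ⁻¹`
  have hδle : δ ≤ 1 := by
    have h1 : (b ^ k₀)⁻¹ ≤ 1 := inv_le_one_of_one_le₀ (one_le_pow₀ hb.le)
    linarith
  have hinv1 : (1:ℝ) ≤ δ⁻¹ := (one_le_inv₀ hδ0).2 hδle
  -- the `b`-adic scale of `δ`: `b^k ≤ δ⁻¹ < b^(k+1)`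
  obtain ⟨k, hk1, hk2⟩ := exists_nat_pow_near hinv1 hb
  have hkk₀ : k₀ ≤ k := by
    have h1 : b ^ k₀ < δ⁻¹ := (lt_inv_comm₀ hδ0 (by positivity)).1 hδ1
    exact Nat.lt_succ_iff.mp ((pow_lt_pow_iff_right₀ hb).1 (h1.trans hk2))
  -- the residual dilation `c = δ⁻¹ / b^k ∈ [1, b]`
  set c : ℝ := δ⁻¹ / b ^ k with hc
  have hbk : (0:ℝ) < b ^ k := by positivity
  have hc1 : 1 ≤ c := (one_le_div hbk).2 hk1
  have hc2 : c ≤ b := by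
    rw [hc, div_le_iff₀ hbk]
    rw [pow_succ] at hk2
    linarith
  have hcpos : 0 < c := lt_of_lt_of_le one_pos hc1
  have hδeq : (b ^ k)⁻¹ / c = δ := by
    rw [hc]
    field_simp
  -- exact mesh identity + dilation covariance
  have hmesh := rescaledCorrelator_mesh_div G Δ n (u := (b ^ k)⁻¹) (by positivity) hcpos y
  rw [hδeq] at hmesh
  have hT : Tn y = c ^ ((n : ℝ) * Δ) * Tn (fun i => c • y i) := by
    rw [hsc c hc1 hc2 y (hK hy), ← mul_assoc, ← Real.rpow_add hcpos]
    have h0 : (n : ℝ) * Δ + -(n : ℝ) * Δ = 0 := by ring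
    rw [h0, Real.rpow_zero, one_mul]
  have hmem : (fun i => c • y i) ∈ K' := ⟨⟨c, y⟩, ⟨⟨hc1, hc2⟩, hy⟩, rfl⟩
  have hest := hk₀ k hkk₀ _ hmem
  rw [Real.dist_eq] at hest ⊢
  rw [hmesh, hT, ← mul_sub, abs_mul, abs_of_pos (Real.rpow_pos_of_pos hcpos _)]
  have hcM : c ^ ((n : ℝ) * Δ) ≤ M :=
    calc c ^ ((n : ℝ) * Δ) ≤ c ^ |(n : ℝ) * Δ| :=
          Real.rpow_le_rpow_of_exponent_le hc1 (le_abs_self _)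
      _ ≤ b ^ |(n : ℝ) * Δ| := Real.rpow_le_rpow hcpos.le hc2 (abs_nonneg _)
  calc c ^ ((n : ℝ) * Δ) * |Tn (fun i => c • y i) -
          rescaledCorrelator G (fun δ => δ ^ (-Δ)) n ((b ^ k)⁻¹) (fun i => c • y i)|
        ≤ M * |Tn (fun i => c • y i) -
          rescaledCorrelator G (fun δ => δ ^ (-Δ)) n ((b ^ k)⁻¹) (fun i => c • y i)| :=
        mul_le_mul_of_nonneg_right hcM (abs_nonneg _)
    _ < M * (ε / M) := mul_lt_mul_of_pos_left hest hMpos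
    _ = ε := mul_div_cancel₀ _ hMpos.ne'

/-- **Lemma A, dyadic case on `ℤ³`** (the shape used by the reduction of the crux): dyadic locally
uniform convergence of the canonically renormalised `n`-point correlators of a lattice family `G`
plus scale covariance of the limit `Tₙ` (all `c > 0`, all configurations) give convergence along
the full filter `δ → 0⁺`. [folklore] -/
theorem tendstoLocallyUniformlyOn_nhdsGT_of_dyadic :
    ∀ (G : LatticeCorrFamily 3) (Δ : ℝ) (n : ℕ) (Tn : (Fin n → EuclideanSpace ℝ (Fin 3)) → ℝ),
      TendstoLocallyUniformlyOn
        (fun k : ℕ => rescaledCorrelator G (fun δ => δ ^ (-Δ)) n (((2:ℝ) ^ k)⁻¹)) Tn atTop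
        (NonCoincident 3 n) →
      (∀ c : ℝ, 0 < c → ∀ x : Fin n → EuclideanSpace ℝ (Fin 3),
        Tn (fun i => c • x i) = c ^ (-(n : ℝ) * Δ) * Tn x) →
      TendstoLocallyUniformlyOn (rescaledCorrelator G (fun δ => δ ^ (-Δ)) n) Tn (𝓝[>] (0 : ℝ))
        (NonCoincident 3 n) := by
  intro G Δ n Tn hd hsc
  exact tendstoLocallyUniformlyOn_nhdsGT_of_geometricMesh G Δ n Tn 2 one_lt_two hd
    (fun c hc1 _ x _ => hsc c (lt_of_lt_of_le one_pos hc1) x)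

end Summit.CriticalPhenomena.Ising3DConformalLimit.PrecisionLaplacianMoebiusLimitOfTwoPointLaw

end
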